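import Summits.CriticalPhenomena.PercolationContinuityZ3.Theorems.PercBudgetLadderPinholeClosingShellHalving

/-!
# Crux `PercBudgetLadder.PinholeClosing` (stmt-CriticalPhenomena-5249): the dichotomy `PinholeClosing ∨ θ(p_c) = 0`

Lead `prover-line-stmt-CriticalPhenomena-5249-c4-0` (sixth lead), 2026-08-17.  A status certificate for the crux
AS TYPED, composing two landed results:

* `Negative.not_budgetTightness_false_and_pinholeClosing_false` (disprover, `…/PinholeClosing/Negative/…Resistance`):
  r2 (`BudgetTightness`) and r3 (`PinholeClosing`) cannot both fail — if budgets are not tight, the premise of r3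
  at `(k+1, l, c)` holds for finitely many `n` only and `c'` is a finite minimum of positive numbers;
* `percolationContinuityZ3_of_budgetTightness` (lead c3, `…ShellHalving`): `BudgetTightness → PercolationContinuityZ3`
  (shell merge + two-sided cut, every budget level; through `critAnnulusBlockedIO_of_budgetTightness`).

Consequences proved here (pure logic on top of those two):

* `budgetTightness_of_not_pinholeClosing`, `critAnnulusBlockedIO_of_not_pinholeClosing`,
  `percolationContinuityZ3_of_not_pinholeClosing`: a REFUTATION of the typed crux would prove r2, the route's
  target X = `CritAnnulusBlockedIO`, and the sub-problem `PercolationContinuityZ3` (θ(p_c) = 0 on ℤ³) outright;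
* `pinholeClosing_or_percolationContinuityZ3 : PinholeClosing ∨ PercolationContinuityZ3` and
  `pinholeClosing_of_not_percolationContinuityZ3`: in every world in which the sub-problem is false the typed crux
  is TRUE (vacuously in the limit);
* `continuity_and_target_of_premise_io`: the only non-vacuous case of the typed crux at `(k, l, c)` — its premise
  holding for infinitely many `n` — already yields `PercolationContinuityZ3 ∧ CritAnnulusBlockedIO`.  Any future
  line on the typed decl may therefore assume θ(p_c) = 0 and X for free (one-arm decay `P(0 ↔ ∂B(R)) → 0`, an UPPER
  bound on critical connectivity, was missing from the list of usable inputs in `Cruxes/PinholeClosing/LEAD-c2-NOTE-1.md` §1).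

Reading for the planner: r3 as typed is route-irrelevant in both directions — it cannot be refuted without settling
the sub-problem positively, and it is not needed to settle it (`percolationContinuityZ3_of_budgetTightness`); the
consumable content is the landed `pinholeClosingRestated_proof`.  No definitions in this file.
-/

namespace Summit.CriticalPhenomena.PercolationContinuityZ3.Theorems

open Literature.Probability.Percolation Literature.Probability.LatticeModels
open Summit.CriticalPhenomena.PercolationContinuityZ3.Theses
open Summit.CriticalPhenomena.PercolationContinuityZ3.Theorems.PinholeClosing

/-- **¬r3 ⟹ r2.**  If the typed crux `PinholeClosing` fails then the critical budgets are tight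
(`BudgetTightness`): contrapositive packaging of `Negative.not_budgetTightness_false_and_pinholeClosing_false`. -/
theorem budgetTightness_of_not_pinholeClosing (h : ¬ PercBudgetLadder.PinholeClosing) :
    PercBudgetLadder.BudgetTightness := by
  by_contra hBT
  exact Negative.not_budgetTightness_false_and_pinholeClosing_false ⟨hBT, h⟩

/-- **¬r3 ⟹ X.**  A refutation of the typed crux proves the route's own target `CritAnnulusBlockedIO`
(via `budgetTightness_of_not_pinholeClosing` and lead c3's `critAnnulusBlockedIO_of_budgetTightness`). -/
theorem critAnnulusBlockedIO_of_not_pinholeClosing (h : ¬ PercBudgetLadder.PinholeClosing) :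
    PercBudgetLadder.CritAnnulusBlockedIO :=
  critAnnulusBlockedIO_of_budgetTightness (budgetTightness_of_not_pinholeClosing h)

/-- **¬r3 ⟹ θ(p_c) = 0.**  A refutation of the typed crux proves the sub-problem `PercolationContinuityZ3`
(via `budgetTightness_of_not_pinholeClosing` and lead c3's `percolationContinuityZ3_of_budgetTightness`). -/
theorem percolationContinuityZ3_of_not_pinholeClosing (h : ¬ PercBudgetLadder.PinholeClosing) :
    _root_.PercolationContinuityZ3 :=
  percolationContinuityZ3_of_budgetTightness (budgetTightness_of_not_pinholeClosing h)

/-- **The dichotomy.**  `PinholeClosing ∨ PercolationContinuityZ3`: the typed crux holds, or the sub-problem it was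
filed to serve holds (classically, from `percolationContinuityZ3_of_not_pinholeClosing`). -/
theorem pinholeClosing_or_percolationContinuityZ3 :
    PercBudgetLadder.PinholeClosing ∨ _root_.PercolationContinuityZ3 := by
  by_cases h : PercBudgetLadder.PinholeClosing
  · exact Or.inl h
  · exact Or.inr (percolationContinuityZ3_of_not_pinholeClosing h)

/-- **Registered form** (`stub_pinholeClosingDichotomy` on stmt-CriticalPhenomena-5249): the dichotomy, by
`pinholeClosing_or_percolationContinuityZ3`. -/
theorem stub_pinholeClosingDichotomy :
    Summit.CriticalPhenomena.PercolationContinuityZ3.Theses.PercBudgetLadder.PinholeClosing ∨ _root_.PercolationContinuityZ3 :=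
  pinholeClosing_or_percolationContinuityZ3

/-- **In a world with θ(p_c) > 0 the typed crux is true.**  `¬PercolationContinuityZ3 → PinholeClosing`
(the disjunction `pinholeClosing_or_percolationContinuityZ3` read from the other side). -/
theorem pinholeClosing_of_not_percolationContinuityZ3 (h : ¬ _root_.PercolationContinuityZ3) :
    PercBudgetLadder.PinholeClosing :=
  (pinholeClosing_or_percolationContinuityZ3.resolve_right h)

/-- **The non-vacuous case of the typed crux already wins.**  Fix `k`, `l ≥ 2`, `c > 0`.  If the premise of
`PinholeClosing` at `(k, l, c)` — budget-`(k+1)` blocking of `box n → ∂ⁱⁿ box (l n)` with probability `≥ c` — holds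
for infinitely many `n` (the only case in which the uniform constant `c'` is not a finite minimum of positive
numbers), then `BudgetTightness` holds with witnesses `(k+1, l, c)`, hence `PercolationContinuityZ3` and the target
`CritAnnulusBlockedIO` (lead c3's theorems).  So every future attack on the typed rung may assume θ(p_c) = 0 and X. -/
theorem continuity_and_target_of_premise_io (k l : ℕ) (c : ℝ) (hl : 2 ≤ l) (hc : 0 < c)
    (hio : ∀ N : ℕ, ∃ n : ℕ, N ≤ n ∧ c ≤ (Literature.Probability.Percolation.bondPercolation (Literature.Probability.LatticeModels.zdGraph 3) (Literature.Probability.Percolation.criticalProbI 3)).real {ω | ∃ S : Finset (Sym2 (Literature.Probability.LatticeModels.Site 3)), S.card ≤ k + 1 ∧ ¬ ∃ x ∈ Literature.Probability.LatticeModels.box 3 n, ∃ y ∈ Literature.Probability.LatticeModels.innerBoundary (Literature.Probability.LatticeModels.zdGraph 3) (Literature.Probability.LatticeModels.box 3 (l * n)), (ω \ ↑S) ∈ Literature.Probability.Percolation.openConnIn ↑(Literature.Probability.LatticeModels.box 3 (l * n)) x y}) :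
    _root_.PercolationContinuityZ3 ∧ PercBudgetLadder.CritAnnulusBlockedIO := by
  have hBT : PercBudgetLadder.BudgetTightness := ⟨k + 1, l, c, hl, hc, hio⟩
  exact ⟨percolationContinuityZ3_of_budgetTightness hBT, critAnnulusBlockedIO_of_budgetTightness hBT⟩

/-- **The typed crux reduces to its non-vacuous case.**  `PinholeClosing` holds as soon as, for every `k`,
`l ≥ 2`, `c > 0` whose premise holds for infinitely many `n`, a uniform `c' > 0` bounds the budget-`k` blocking
probability of `box n → ∂ⁱⁿ box (2 l n)` from below at every `n ≥ 1` where the premise holds; in the remaining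
(eventually-vacuous) case `c'` is the finite minimum supplied by `Negative.exists_pos_lower_bound` and
`Negative.blockProb_pos`.  Together with `continuity_and_target_of_premise_io` this isolates exactly what is open. -/
theorem pinholeClosing_of_io_case
    (h : ∀ (k l : ℕ) (c : ℝ), 2 ≤ l → 0 < c →
      (∀ N : ℕ, ∃ n : ℕ, N ≤ n ∧ c ≤ (Literature.Probability.Percolation.bondPercolation (Literature.Probability.LatticeModels.zdGraph 3) (Literature.Probability.Percolation.criticalProbI 3)).real {ω | ∃ S : Finset (Sym2 (Literature.Probability.LatticeModels.Site 3)), S.card ≤ k + 1 ∧ ¬ ∃ x ∈ Literature.Probability.LatticeModels.box 3 n, ∃ y ∈ Literature.Probability.LatticeModels.innerBoundary (Literature.Probability.LatticeModels.zdGraph 3) (Literature.Probability.LatticeModels.box 3 (l * n)), (ω \ ↑S) ∈ Literature.Probability.Percolation.openConnIn ↑(Literature.Probability.LatticeModels.box 3 (l * n)) x y}) →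
      ∃ c' : ℝ, 0 < c' ∧ ∀ n : ℕ, 1 ≤ n → c ≤ (Literature.Probability.Percolation.bondPercolation (Literature.Probability.LatticeModels.zdGraph 3) (Literature.Probability.Percolation.criticalProbI 3)).real {ω | ∃ S : Finset (Sym2 (Literature.Probability.LatticeModels.Site 3)), S.card ≤ k + 1 ∧ ¬ ∃ x ∈ Literature.Probability.LatticeModels.box 3 n, ∃ y ∈ Literature.Probability.LatticeModels.innerBoundary (Literature.Probability.LatticeModels.zdGraph 3) (Literature.Probability.LatticeModels.box 3 (l * n)), (ω \ ↑S) ∈ Literature.Probability.Percolation.openConnIn ↑(Literature.Probability.LatticeModels.box 3 (l * n)) x y} → c' ≤ (Literature.Probability.Percolation.bondPercolation (Literature.Probability.LatticeModels.zdGraph 3) (Literature.Probability.Percolation.criticalProbI 3)).real {ω | ∃ S : Finset (Sym2 (Literature.Probability.LatticeModels.Site 3)), S.card ≤ k ∧ ¬ ∃ x ∈ Literature.Probability.LatticeModels.box 3 n, ∃ y ∈ Literature.Probability.LatticeModels.innerBoundary (Literature.Probability.LatticeModels.zdGraph 3) (Literature.Probability.LatticeModels.box 3 (2 * l * n)), (ω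 \ ↑S) ∈ Literature.Probability.Percolation.openConnIn ↑(Literature.Probability.LatticeModels.box 3 (2 * l * n)) x y}) :
    PercBudgetLadder.PinholeClosing := by
  intro k l c hl hc
  by_cases hio : ∀ N : ℕ, ∃ n : ℕ, N ≤ n ∧ c ≤ (bondPercolation (zdGraph 3) (criticalProbI 3)).real {ω | ∃ S : Finset (Sym2 (Site 3)), S.card ≤ k + 1 ∧ ¬ ∃ x ∈ box 3 n, ∃ y ∈ innerBoundary (zdGraph 3) (box 3 (l * n)), (ω \ ↑S) ∈ openConnIn ↑(box 3 (l * n)) x y}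
  · exact h k l c hl hc hio
  · -- eventually-vacuous case: the premise fails from some `N` on; `c'` = a finite minimum of positive numbers
    have hN : ∃ N : ℕ, ∀ n : ℕ, N ≤ n → ¬ c ≤ (bondPercolation (zdGraph 3) (criticalProbI 3)).real {ω | ∃ S : Finset (Sym2 (Site 3)), S.card ≤ k + 1 ∧ ¬ ∃ x ∈ box 3 n, ∃ y ∈ innerBoundary (zdGraph 3) (box 3 (l * n)), (ω \ ↑S) ∈ openConnIn ↑(box 3 (l * n)) x y} := by
      by_contra hcon
      refine hio fun N => ?_
      by_contra h2
      exact hcon ⟨N, fun n hn hle => h2 ⟨n, hn, hle⟩⟩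
    obtain ⟨N, hN⟩ := hN
    obtain ⟨c', hc', hmin⟩ := Negative.exists_pos_lower_bound
      (fun n => (bondPercolation (zdGraph 3) (criticalProbI 3)).real {ω : BondConfig (Site 3) | ∃ S : Finset (Sym2 (Site 3)), S.card ≤ k ∧ ¬ ∃ x ∈ box 3 n, ∃ y ∈ innerBoundary (zdGraph 3) (box 3 (2 * l * n)), (ω \ (↑S : Set (Sym2 (Site 3)))) ∈ openConnIn (↑(box 3 (2 * l * n)) : Set (Site 3)) x y})
      (fun n hn => Negative.blockProb_pos (by nlinarith)) N
    refine ⟨c', hc', fun n hn hprem => hmin n hn ?_⟩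
    by_contra hnN
    exact hN n (not_lt.1 hnN) hprem

end Summit.CriticalPhenomena.PercolationContinuityZ3.Theorems
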